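import Summits.AnomalousDissipation.AnomalousDissipation.Theses.MirrorVariety

/-!
# Birth skeleton (BC3) of the piece `CellLaminarComponentStaysLoud` (stmt-AnomalousDissipation-18425; route MirrorVariety,
# strategist split of `GalerkinSteadyZerothLaw`, 2026-08-17)

Two named stubs and a real composition:
* `stub_powerIdentity` (PROVABLE NOW, S): at every real solenoidal zero of the cell-forced Galerkin field the dissipation equals the
  power injected by the force, `ν·4π²Σ|k|²‖c_k‖² = Re Σ⟨C_k, c_k⟩` — the landed `LaminarNeverLoud.Negative.dissipation_eq_power`
  (Temam 1979 Ch. II (1.29)) with the reality of the cell vector (`isConjSymm_cellCoeff`); it turns the loudness floor into a floor on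
  the projection of the state onto the FOUR forcing modes;
* `stub_projectionFloor` (OPEN — the content of the piece): on the bounded laminar component, in the resolved window, the
  forcing-shell projection `Re Σ⟨C_k, c_k⟩` stays `≥ ε` (non-depletion = the flow keeps a fixed correlation with the force);
* `CellLaminarComponentStaysLoud_of : stub_powerIdentity → stub_projectionFloor → CellLaminarComponentStaysLoud` (real proof:
  members of the component are members of `F_N(E)`, i.e. real solenoidal zeros; rewrite the dissipation by the identity).
-/

namespace Summit.AnomalousDissipation.AnomalousDissipation.Cruxes.CellLaminarComponentStaysLoud.Birth

set_option linter.dupNamespace false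

open Filter Set
open Summit.AnomalousDissipation.AnomalousDissipation.Theses.MirrorVariety (CellLaminarComponentStaysLoud)

/-- **stub_powerIdentity** (provable now): dissipation = power at every steady state of the cell-forced Galerkin system. -/
theorem stub_powerIdentity : ∀ C : (Fin 3 → ℤ) → EuclideanSpace ℂ (Fin 3), C = (fun l : Fin 3 → ℤ => if l ∈ Fintype.piFinset ![({1, -1} : Finset ℤ), {1, -1}, {0}] then (Complex.I * (l 0 : ℂ) * (l 1 : ℂ) / 4) • !₂[-((l 1 : ℤ) : ℂ), ((l 0 : ℤ) : ℂ), 0] else 0) → ∀ N : ℕ, ∀ S : Finset (Fin 3 → ℤ), S = (Literature.Analysis.FunctionSpaces.Torus.freqBall N).erase (0 : Fin 3 → ℤ) → ∀ (ν : ℝ) (c : ↥S → EuclideanSpace ℂ (Fin 3)), c ∈ Literature.Analysis.FluidPDE.galerkinSubspace S → Literature.Analysis.FluidPDE.galerkinRHS S ν (fun k : ↥S => C k) c = 0 → ν * (4 * Real.pi ^ 2 * ∑ k : ↥S, Literature.Analysis.FunctionSpaces.Torus.freqNormSq (k : Fin 3 → ℤ) * ‖c k‖ ^ 2) = ∑ k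 : ↥S, (inner ℂ (C k) (c k)).re := by
  sorry

/-- **stub_projectionFloor** (open): the forcing-shell projection does not deplete along the bounded laminar component. -/
theorem stub_projectionFloor : ∀ C : (Fin 3 → ℤ) → EuclideanSpace ℂ (Fin 3), C = (fun l : Fin 3 → ℤ => if l ∈ Fintype.piFinset ![({1, -1} : Finset ℤ), {1, -1}, {0}] then (Complex.I * (l 0 : ℂ) * (l 1 : ℂ) / 4) • !₂[-((l 1 : ℤ) : ℂ), ((l 0 : ℤ) : ℂ), 0] else 0) → ∀ E ν₀ : ℝ, 0 < ν₀ → ∃ ν₁ ε κ : ℝ, 0 < ν₁ ∧ 0 < ε ∧ ∃ N₁ : ℕ, ∀ N : ℕ, N₁ ≤ N → ∀ S : Finset (Fin 3 → ℤ), S = (Literature.Analysis.FunctionSpaces.Torus.freqBall N).erase (0 : Fin 3 → ℤ) → ∀ F : Set ((↥S → EuclideanSpace ℂ (Fin 3)) × ℝ), F = {z | z.1 ∈ Literature.Analysis.FluidPDE.galerkinSubspace S ∧ (∀ k : ↥S, Odd ((k : Fin 3 → ℤ) 0 + (k : Fin 3 → ℤ) 1) → z.1 k = 0) ∧ 0 <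 z.2 ∧ Literature.Analysis.FluidPDE.galerkinRHS S z.2 (fun k : ↥S => C k) z.1 = 0 ∧ ∑ k : ↥S, ‖z.1 k‖ ^ 2 ≤ E} → ∀ z ∈ connectedComponentIn F ((fun k : ↥S => (8 * Real.pi ^ 2 * ν₀)⁻¹ • C k), ν₀), κ / (N : ℝ) ^ 2 ≤ z.2 → z.2 ≤ ν₁ → ε ≤ ∑ k : ↥S, (inner ℂ (C k) (z.1 k)).re := by
  sorry

/-- **Composition**: the piece from the two stubs. [folklore] -/
theorem CellLaminarComponentStaysLoud_of : (∀ C : (Fin 3 → ℤ) → EuclideanSpace ℂ (Fin 3), C = (fun l : Fin 3 → ℤ => if l ∈ Fintype.piFinset ![({1, -1} : Finset ℤ), {1, -1}, {0}] then (Complex.I * (l 0 : ℂ) * (l 1 : ℂ) / 4) • !₂[-((l 1 : ℤ) : ℂ), ((l 0 : ℤ) : ℂ), 0] else 0) → ∀ N : ℕ, ∀ S : Finset (Fin 3 → ℤ), S = (Literature.Analysis.FunctionSpaces.Torus.freqBall N).erase (0 : Fin 3 → ℤ) → ∀ (ν : ℝ) (c : ↥S → EuclideanSpace ℂ (Fin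 3)), c ∈ Literature.Analysis.FluidPDE.galerkinSubspace S → Literature.Analysis.FluidPDE.galerkinRHS S ν (fun k : ↥S => C k) c = 0 → ν * (4 * Real.pi ^ 2 * ∑ k : ↥S, Literature.Analysis.FunctionSpaces.Torus.freqNormSq (k : Fin 3 → ℤ) * ‖c k‖ ^ 2) = ∑ k : ↥S, (inner ℂ (C k) (c k)).re) → (∀ C : (Fin 3 → ℤ) → EuclideanSpace ℂ (Fin 3), C = (fun l : Fin 3 → ℤ => if l ∈ Fintype.piFinset ![({1, -1} : Finset ℤ), {1, -1}, {0}] then (Complex.I * (l 0 : ℂ) * (l 1 : ℂ) / 4) • !₂[-((l 1 : ℤ) : ℂ), ((l 0 : ℤ) : ℂ), 0] else 0) → ∀ E ν₀ : ℝ, 0 < ν₀ → ∃ ν₁ ε κ : ℝ, 0 < ν₁ ∧ 0 < ε ∧ ∃ N₁ : ℕ, ∀ N : ℕ, N₁ ≤ N → ∀ S : Finset (Fin 3 → ℤ), S = (Literature.Analysis.FunctionSpaces.Torus.freqBall N).erase (0 : Fin 3 → ℤ) → ∀ F : Set ((↥S → EuclideanSpace ℂ (Fin 3)) × ℝ), F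 = {z | z.1 ∈ Literature.Analysis.FluidPDE.galerkinSubspace S ∧ (∀ k : ↥S, Odd ((k : Fin 3 → ℤ) 0 + (k : Fin 3 → ℤ) 1) → z.1 k = 0) ∧ 0 < z.2 ∧ Literature.Analysis.FluidPDE.galerkinRHS S z.2 (fun k : ↥S => C k) z.1 = 0 ∧ ∑ k : ↥S, ‖z.1 k‖ ^ 2 ≤ E} → ∀ z ∈ connectedComponentIn F ((fun k : ↥S => (8 * Real.pi ^ 2 * ν₀)⁻¹ • C k), ν₀), κ / (N : ℝ) ^ 2 ≤ z.2 → z.2 ≤ ν₁ → ε ≤ ∑ k : ↥S, (inner ℂ (C k) (z.1 k)).re) → CellLaminarComponentStaysLoud := by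
  intro hpow hproj C hC E ν₀ hν₀
  obtain ⟨ν₁, ε, κ, hν₁, hε, N₁, h⟩ := hproj C hC E ν₀ hν₀
  refine ⟨ν₁, ε, κ, hν₁, hε, N₁, ?_⟩
  intro N hN S hS F hF z hz hκ hzν
  have hzF : z ∈ F := connectedComponentIn_subset _ _ hz
  rw [hF] at hzF
  simp only [Set.mem_setOf_eq] at hzF
  obtain ⟨hzV, -, -, hz0, -⟩ := hzF
  rw [hpow C hC N S hS z.2 z.1 hzV hz0]
  exact h N hN S hS F hF z hz hκ hzν

/-- The piece from its two (sorried) stubs, by name — usage witness of the composition. [folklore] -/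
theorem cellLaminarComponentStaysLoud_of_stubs : CellLaminarComponentStaysLoud := CellLaminarComponentStaysLoud_of stub_powerIdentity stub_projectionFloor

end Summit.AnomalousDissipation.AnomalousDissipation.Cruxes.CellLaminarComponentStaysLoud.Birth
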